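import Summits.QuantumFields.BalabanUV.Beta.GAN24.SubAveragingDirichlet

/-!
# `BalabanUV.Beta.GAN24.SubAveragingCore` — binder row G-an2-4 ∕ (CONV-C), programme «SUBAVG-RATE»
# (ROUTES-GAN24 R2-S1∕S2 ∘ R3-S3 executed at `U = 1` in the fibre∕strip currency), FILE 2a:
# ALIAS BOOKKEEPING FOR THE CORE ESTIMATE — finer aliases `K = k + n·m`, the principal sub-alias, the exact pairing of the
# alias weights at the two levels, and the centred momentum (the estimate itself is the sibling `SubAveragingCoreEstimate`)

NOT IN PRINT; OUR PROOF ATTEMPT (prover part P3 of row G-an2-4, fibre∕strip lineage, gen 22; CRUX TEAM (2), ruling «YM REDIRECT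
TOWARDS THE SUMMIT», 2026-08-21).  HONEST DEPENDENCY (cell records, verbatim): «continuum YM on T⁴ ⇐ BetaPertH ∧ nine spine
estimates (0/9 proved); BetaPertH ⇐ (D1) ∧ (D4) ∧ CAP+tail; G-an2-4 gates asym, D1 and NE2/3/4.»  HONEST FRAMING (cell contract,
verbatim): «discharging `BetaPertH` makes Bałaban's UV stability UNCONDITIONAL — a real constructive-QFT result; it is NOT the
continuum limit and NOT the Clay problem.»  ABSOLUTE RULE: nothing printed is a hypothesis; [folklore] estimates over the symbols
of `Literature.….B4Strip` ∕ `B4StripCauchy` ∕ `B4StripSums` (vendored there with citation tags) and the sibling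
`SubAveragingDirichlet`.  No `def … : Prop`, no sorry.

## Rôle
FILE 2b `SubAveragingCoreEstimate` proves, for every non-zero coarse alias `k` and every `p` in the complex fat region, that the
once-sub-averaged finer free propagator `T_k(p) = Σ_m W1(Kof k m)(p)∕(Δ^{ξ∕L}+m²)(p+2π·Kof k m)` is within `CT(d,L,m²)∕n²` of the
coarser `1∕(Δ^ξ+m²)(p+2πk)`.  This file supplies its combinatorics: per coordinate the principal sub-alias `m⋆(k_ν)` (`mstar`: `0`
if `2k_ν < n`, `L−1` otherwise) is the one congruent to the CENTRED representative `k̃_ν ∈ [−n∕2, n∕2)` of `k_ν`; at it both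
symbols are functions of the centred momentum `zc = p_ν + 2πk̃_ν` (periodicity) with `‖zc‖ ≤ 11·ω_n(k_ν)`, the alias weights of
`B4StripSums` pair EXACTLY (`W_{nL}(K⋆) = W_n(k)`), and every other sub-alias is far (`W_{nL}(Kof k m) ≥ n²∕4`).

## What is proved here (FILE 2a)
* §0 `norm_prod_sub_one_le` (products of factors `1 + O(e_ν)`), `dir_add_pi_sq`, `swc`∕`swc_add_period`∕`norm_swc_le`∕`norm_swc_sub_one_le`.
* §1 alias bookkeeping: `Kof`, `mstar`, `Mstar`, `Kof_ne_zero`, **`omega_Kof_mstar`**, **`W_Kof_mstar`**, `omega_Kof_far`, **`W_Kof_far`**.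
* §2 the centred momentum `zc`: `Sxi_shift_eq_zc`, `Sxi_mul_Kof_mstar_eq_zc`, `sw_Kof_mstar_eq`, **`norm_zc_le`**, `zc_im`, `fat_coord`.
The sub-weight `W1`, the once-sub-averaged propagator `T` and the CORE estimate `norm_T_sub_inv_le` are in FILE 2b
`SubAveragingCoreEstimate` (same mechanism paragraph).

NOT HERE: the estimate (FILE 2b), the `k = 0` column, `E(nL) − E(n)`, the column assembly (`SubAveragingFibre`); kernels
(`SubAveragingKernel`).  0∕4 row-D1
binders touched; NEVER «G-an2-4 closed»; NOT D1, NOT BetaPertH, NOT continuum, NOT Clay.  Provenance: prover-b2b-balaban-gan24-p3-g22-0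
(unit `b2b-balaban-gan24-p3`, gen 22), 2026-08-21.
-/

noncomputable section

namespace Summit.QuantumFields.BalabanUV.Beta.GAN24.SubAveragingCore

open Complex Finset
open Literature.MathematicalPhysics.QuantumFieldTheory.Balaban1983to89
open Literature.MathematicalPhysics.QuantumFieldTheory.Balaban1983to89.B4Strip
open Literature.MathematicalPhysics.QuantumFieldTheory.Balaban1983to89.B4StripCauchy
open Literature.MathematicalPhysics.QuantumFieldTheory.Balaban1983to89.B4StripSums
open Summit.QuantumFields.BalabanUV.Beta.GAN24.SubAveragingDirichlet
open scoped Real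

variable {d : ℕ}

/-! ## §0 Two generic lemmas and the half-period invariance of the sub-weight -/

/-- [folklore] products of factors close to `1`: if `‖a_i‖ ≤ B` (`B ≥ 1`) and `‖a_i − 1‖ ≤ e_i` (`e_i ≥ 0`) on `s`, then
`‖Π_{i∈s} a_i − 1‖ ≤ B^{|s|} Σ_{i∈s} e_i`. -/
theorem norm_prod_sub_one_le {ι : Type*} [DecidableEq ι] (s : Finset ι) (a : ι → ℂ) {B : ℝ} (hB : 1 ≤ B) (e : ι → ℝ)
    (he : ∀ i ∈ s, 0 ≤ e i) (ha : ∀ i ∈ s, ‖a i‖ ≤ B) (hae : ∀ i ∈ s, ‖a i - 1‖ ≤ e i) :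
    ‖∏ i ∈ s, a i - 1‖ ≤ B ^ s.card * ∑ i ∈ s, e i := by
  induction s using Finset.induction_on with
  | empty => simp
  | insert j s hj ih =>
      have he' : ∀ i ∈ s, 0 ≤ e i := fun i hi => he i (Finset.mem_insert_of_mem hi)
      have ha' : ∀ i ∈ s, ‖a i‖ ≤ B := fun i hi => ha i (Finset.mem_insert_of_mem hi)
      have hae' : ∀ i ∈ s, ‖a i - 1‖ ≤ e i := fun i hi => hae i (Finset.mem_insert_of_mem hi)
      have ih' := ih he' ha' hae'
      rw [Finset.prod_insert hj, Finset.sum_insert hj, Finset.card_insert_of_notMem hj]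
      have e1 : a j * ∏ i ∈ s, a i - 1 = a j * (∏ i ∈ s, a i - 1) + (a j - 1) := by ring
      rw [e1]
      have hBp : 1 ≤ B ^ s.card := one_le_pow₀ hB
      have hsum : 0 ≤ ∑ i ∈ s, e i := Finset.sum_nonneg he'
      have hej : 0 ≤ e j := he j (Finset.mem_insert_self j s)
      calc ‖a j * (∏ i ∈ s, a i - 1) + (a j - 1)‖ ≤ ‖a j‖ * ‖∏ i ∈ s, a i - 1‖ + ‖a j - 1‖ := by
            refine (norm_add_le _ _).trans ?_; rw [norm_mul]
        _ ≤ B * (B ^ s.card * ∑ i ∈ s, e i) + e j := by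
            gcongr
            · exact ha j (Finset.mem_insert_self j s)
            · exact hae j (Finset.mem_insert_self j s)
        _ ≤ B ^ (s.card + 1) * (e j + ∑ i ∈ s, e i) := by
            rw [pow_succ]
            nlinarith [mul_nonneg (sub_nonneg.mpr hBp) hej, mul_nonneg (sub_nonneg.mpr hB) (mul_nonneg (zero_le_one.trans hBp) hej),
              mul_nonneg (zero_le_one.trans hB) (mul_nonneg (zero_le_one.trans hBp) hsum)]

/-- [folklore] the Dirichlet kernel changes by the sign `e^{i(1−L)π}` under `θ ↦ θ + π`; its SQUARE is `π`-periodic. -/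
theorem dir_add_pi_sq (L : ℕ) (θ : ℂ) : dir L (θ + π) ^ 2 = dir L θ ^ 2 := by
  have key : dir L (θ + π) = cexp ((1 - (L : ℂ)) * π * I) * dir L θ := by
    unfold dir
    rw [Finset.mul_sum]
    refine Finset.sum_congr rfl fun ρ _ => ?_
    rw [← Complex.exp_add]
    have e : I * ((2 * (ρ : ℂ) - L + 1) * (θ + π)) = ((1 - (L : ℂ)) * π * I + I * ((2 * (ρ : ℂ) - L + 1) * θ)) + (ρ : ℂ) * (2 * π * I) := by
      ring
    rw [e, Complex.exp_add _ ((ρ : ℂ) * (2 * π * I)), Complex.exp_nat_mul_two_pi_mul_I, mul_one]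
  rw [key, mul_pow, ← Complex.exp_nat_mul]
  have e2 : ((2 : ℕ) : ℂ) * ((1 - (L : ℂ)) * π * I) = ((1 - (L : ℤ) : ℤ) : ℂ) * (2 * π * I) := by push_cast; ring
  rw [e2, Complex.exp_int_mul_two_pi_mul_I, one_mul]

/-- [folklore] the sub-weight as a function of the SHIFTED momentum alone: `swc n L w := D_L(ang n L w)²∕L²`, so that
`sw n L K z = swc n L (z + 2πK)` definitionally. -/
def swc (n L : ℕ) (w : ℂ) : ℂ := dir L (ang n L w) ^ 2 / (L : ℂ) ^ 2

/-- [folklore] `sw n L K z = swc n L (z + 2πK)`. -/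
theorem sw_eq_swc (n L K : ℕ) (z : ℂ) : sw n L K z = swc n L (z + 2 * π * K) := rfl

/-- [folklore] `swc` is `2πnL`-periodic (the angle moves by `π`, `dir_add_pi_sq`). -/
theorem swc_add_period (n L : ℕ) (hn : 1 ≤ n) (hL : 1 ≤ L) (w : ℂ) :
    swc n L (w + 2 * π * ((n : ℂ) * L)) = swc n L w := by
  unfold swc
  have e : ang n L (w + 2 * π * ((n : ℂ) * L)) = ang n L w + π := by
    unfold ang
    have hL' : (L : ℂ) ≠ 0 := Nat.cast_ne_zero.mpr (by omega)
    have hn' : (n : ℂ) ≠ 0 := Nat.cast_ne_zero.mpr (by omega)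
    field_simp
  rw [e, dir_add_pi_sq]

/-- [folklore] bounds for `swc` on `|Im w| ≤ 1` (from `norm_sw_le` ∕ `norm_sw_sub_one_le` at `K = 0`). -/
theorem norm_swc_le (n L : ℕ) (hn : 1 ≤ n) (hL : 1 ≤ L) (w : ℂ) (hw : |w.im| ≤ 1) : ‖swc n L w‖ ≤ 4 := by
  have h := norm_sw_le n L hn hL 0 w hw
  rwa [sw_eq_swc, Nat.cast_zero, mul_zero, add_zero] at h

/-- [folklore] `‖swc n L w − 1‖ ≤ 3‖w‖²∕(4n²)` on `|Im w| ≤ 1`. -/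
theorem norm_swc_sub_one_le (n L : ℕ) (hn : 1 ≤ n) (hL : 1 ≤ L) (w : ℂ) (hw : |w.im| ≤ 1) :
    ‖swc n L w - 1‖ ≤ 3 * ‖w‖ ^ 2 / (4 * (n : ℝ) ^ 2) := by
  have h := norm_sw_sub_one_le n L hn hL 0 w hw
  rw [sw_eq_swc, Nat.cast_zero, mul_zero, add_zero, norm_ang] at h
  have hn1 : (1 : ℝ) ≤ n := by exact_mod_cast hn
  have hL1 : (1 : ℝ) ≤ L := by exact_mod_cast hL
  calc ‖swc n L w - 1‖ ≤ 3 * (L : ℝ) ^ 2 * (‖w‖ / (2 * n * L)) ^ 2 := h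
    _ = 3 * ‖w‖ ^ 2 / (4 * (n : ℝ) ^ 2) := by field_simp; ring

/-! ## §1 Alias bookkeeping: `K = k + n·m`, the principal sub-alias, and the alias weights `ω`, `W` at the two levels -/

/-- [folklore] the finer alias with coarse residue `k` and sub-index `m`: `Kof k m = k + n·m ∈ (Fin (n·L))^d`. -/
def Kof (n L : ℕ) (k : Fin d → Fin n) (m : Fin d → Fin L) : Fin d → Fin (n * L) := fun ν =>
  ⟨(k ν : ℕ) + n * (m ν : ℕ), by
    have hk := (k ν).isLt
    have hm := (m ν).isLt
    calc (k ν : ℕ) + n * (m ν : ℕ) < n + n * (m ν : ℕ) := by omega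
      _ = n * ((m ν : ℕ) + 1) := by ring
      _ ≤ n * L := Nat.mul_le_mul_left _ hm⟩

/-- [folklore] the value of `Kof`. -/
@[simp] theorem Kof_val (n L : ℕ) (k : Fin d → Fin n) (m : Fin d → Fin L) (ν : Fin d) :
    ((Kof n L k m ν : Fin (n * L)) : ℕ) = (k ν : ℕ) + n * (m ν : ℕ) := rfl

/-- [folklore] `Kof k m` has a zero coordinate iff both `k` and `m` do there (`n ≥ 1`). -/
theorem Kof_apply_eq_zero_iff (n L : ℕ) [NeZero n] (k : Fin d → Fin n) (m : Fin d → Fin L) (ν : Fin d) :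
    ((Kof n L k m ν : Fin (n * L)) : ℕ) = 0 ↔ (k ν : ℕ) = 0 ∧ (m ν : ℕ) = 0 := by
  rw [Kof_val]
  have hn := NeZero.ne n
  constructor
  · intro h
    refine ⟨by omega, ?_⟩
    have : n * (m ν : ℕ) = 0 := by omega
    rcases Nat.mul_eq_zero.mp this with h' | h'
    · exact absurd h' hn
    · exact h'
  · rintro ⟨h1, h2⟩; rw [h1, h2]; simp

/-- [folklore] a non-zero coarse alias has only non-zero finer aliases above it. -/
theorem Kof_ne_zero (n L : ℕ) [NeZero n] [NeZero L] {k : Fin d → Fin n} (hk : k ≠ fun _ => 0) (m : Fin d → Fin L) :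
    Kof n L k m ≠ fun _ => 0 := by
  intro h
  apply hk
  funext ν
  have h0 : ((Kof n L k m ν : Fin (n * L)) : ℕ) = 0 := by rw [congrFun h ν]; exact Fin.val_zero _
  exact Fin.ext (by rw [Fin.val_zero]; exact ((Kof_apply_eq_zero_iff n L k m ν).mp h0).1)

/-- [folklore] THE PRINCIPAL SUB-ALIAS of a coarse residue `j < n`: `0` if `2j < n` (the centred representative is `j`),
`L − 1` otherwise (the centred representative is `j − n`, whose finer alias is `j + n(L−1) ≡ j − n (mod nL)`). -/
def mstar (n L : ℕ) [NeZero L] (j : Fin n) : Fin L :=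
  if 2 * (j : ℕ) < n then 0 else ⟨L - 1, Nat.sub_lt (Nat.pos_of_ne_zero (NeZero.ne L)) one_pos⟩

/-- [folklore] the principal sub-alias, coordinatewise. -/
def Mstar (n L : ℕ) [NeZero L] (k : Fin d → Fin n) : Fin d → Fin L := fun ν => mstar n L (k ν)

/-- [folklore] the value of `mstar`. -/
theorem mstar_val (n L : ℕ) [NeZero L] (j : Fin n) :
    ((mstar n L j : Fin L) : ℕ) = if 2 * (j : ℕ) < n then 0 else L - 1 := by
  unfold mstar; split_ifs <;> rfl

/-- [folklore] **THE ALIAS WEIGHTS PAIR EXACTLY AT THE PRINCIPAL SUB-ALIAS**: `ω_{nL}(j + n·m⋆(j)) = ω_n(j)`. -/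
theorem omega_Kof_mstar (n L : ℕ) [NeZero L] (j : Fin n) :
    omega (n * L) ((j : ℕ) + n * ((mstar n L j : Fin L) : ℕ)) = omega n (j : ℕ) := by
  have hj := j.isLt
  have hL := Nat.pos_of_ne_zero (NeZero.ne L)
  rw [mstar_val]
  unfold omega
  split_ifs with h
  · rw [mul_zero, add_zero]
    have h1 : ((j : ℕ) : ℝ) + 1 ≤ (n : ℝ) - (j : ℕ) := by
      have : 2 * (j : ℕ) + 1 ≤ n := by omega
      have : (2 * (j : ℕ) + 1 : ℝ) ≤ n := by exact_mod_cast this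
      linarith
    have h2 : ((j : ℕ) : ℝ) + 1 ≤ ((n * L : ℕ) : ℝ) - (j : ℕ) := by
      have : n ≤ n * L := Nat.le_mul_of_pos_right n hL
      have : (n : ℝ) ≤ ((n * L : ℕ) : ℝ) := by exact_mod_cast this
      linarith
    rw [min_eq_left h1, min_eq_left h2]
  · push Not at h
    have e1 : (((j : ℕ) + n * (L - 1) : ℕ) : ℝ) = (j : ℕ) + n * L - n := by
      rw [Nat.cast_add, Nat.cast_mul, Nat.cast_sub hL]; push_cast; ring
    rw [e1]
    have h1 : (n : ℝ) - (j : ℕ) ≤ ((j : ℕ) : ℝ) + 1 := by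
      have : (n : ℝ) ≤ 2 * (j : ℕ) := by exact_mod_cast h
      linarith
    have hn0 : (0 : ℝ) ≤ n := Nat.cast_nonneg n
    have hL1 : (1 : ℝ) ≤ L := by exact_mod_cast hL
    have h2 : ((n * L : ℕ) : ℝ) - ((j : ℕ) + n * L - n) ≤ (j : ℕ) + n * L - n + 1 := by
      push_cast; nlinarith
    rw [min_eq_right h1, min_eq_right h2]
    push_cast; ring

/-- [folklore] **`W_{nL}(Kof k (Mstar k)) = W_n(k)`** (coordinatewise pairing of the alias weights, and the zero pattern agrees). -/
theorem W_Kof_mstar (n L : ℕ) [NeZero n] [NeZero L] (k : Fin d → Fin n) :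
    W (n * L) (Kof n L k (Mstar n L k)) = W n k := by
  unfold W
  refine Finset.sum_congr rfl fun ν _ => ?_
  have hz : (((Kof n L k (Mstar n L k) ν : Fin (n * L)) : ℕ) = 0) ↔ ((k ν : ℕ) = 0) := by
    rw [Kof_apply_eq_zero_iff]
    constructor
    · exact fun h => h.1
    · intro h
      refine ⟨h, ?_⟩
      show ((mstar n L (k ν) : Fin L) : ℕ) = 0
      rw [mstar_val, if_pos]
      rw [h]; exact Nat.pos_of_ne_zero (NeZero.ne n)
  by_cases h0 : (k ν : ℕ) = 0
  · rw [if_pos (hz.mpr h0), if_pos h0]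
  · rw [if_neg (fun h => h0 (hz.mp h)), if_neg h0, Kof_val]
    exact congrArg (· ^ 2) (omega_Kof_mstar n L (k ν))

/-- [folklore] **EVERY NON-PRINCIPAL SUB-ALIAS IS FAR**: `ω_{nL}(j + n·m) ≥ n∕2` for `m ≠ m⋆(j)`. -/
theorem omega_Kof_far (n L : ℕ) [NeZero L] (j : Fin n) (m : Fin L) (hm : m ≠ mstar n L j) :
    (n : ℝ) / 2 ≤ omega (n * L) ((j : ℕ) + n * (m : ℕ)) := by
  have hj := j.isLt
  have hmL := m.isLt
  have hL := Nat.pos_of_ne_zero (NeZero.ne L)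
  have hmv : (m : ℕ) ≠ ((mstar n L j : Fin L) : ℕ) := fun h => hm (Fin.ext h)
  rw [mstar_val] at hmv
  unfold omega
  refine le_min ?_ ?_
  · -- `j + n m + 1 ≥ n/2`
    split_ifs at hmv with h
    · have hm1 : 1 ≤ (m : ℕ) := by omega
      have : n ≤ (j : ℕ) + n * (m : ℕ) := by nlinarith
      have : (n : ℝ) ≤ (((j : ℕ) + n * (m : ℕ) : ℕ) : ℝ) := by exact_mod_cast this
      have hn0 : (0 : ℝ) ≤ n := Nat.cast_nonneg n
      linarith
    · push Not at h
      have : (n : ℝ) ≤ 2 * (j : ℕ) := by exact_mod_cast h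
      have : ((j : ℕ) : ℝ) ≤ (((j : ℕ) + n * (m : ℕ) : ℕ) : ℝ) := by exact_mod_cast Nat.le_add_right _ _
      linarith
  · -- `nL − (j + n m) ≥ n/2`
    split_ifs at hmv with h
    · -- `m ≥ 1`, `j < n/2`: `nL − j − nm ≥ n(L − m) − j ≥ n − j > n/2`
      have hm1 : (m : ℕ) + 1 ≤ L := hmL
      have key : 2 * ((j : ℕ) + n * (m : ℕ)) + n ≤ 2 * (n * L) := by nlinarith
      have : (2 * ((j : ℕ) + n * (m : ℕ)) + n : ℝ) ≤ 2 * (n * L) := by exact_mod_cast key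
      push_cast at this ⊢
      linarith
    · -- `m ≤ L − 2`: `nL − j − nm ≥ 2n − j ≥ n`
      push Not at h
      have hm2 : (m : ℕ) + 2 ≤ L := by omega
      have key : 2 * ((j : ℕ) + n * (m : ℕ)) + n ≤ 2 * (n * L) := by nlinarith
      have : (2 * ((j : ℕ) + n * (m : ℕ)) + n : ℝ) ≤ 2 * (n * L) := by exact_mod_cast key
      push_cast at this ⊢
      linarith

/-- [folklore] **`W_{nL}(Kof k m) ≥ n²∕4` for every non-principal `m ≠ Mstar k`** (one far coordinate suffices). -/
theorem W_Kof_far (n L : ℕ) [NeZero n] [NeZero L] (k : Fin d → Fin n) (m : Fin d → Fin L) (hm : m ≠ Mstar n L k) :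
    (n : ℝ) ^ 2 / 4 ≤ W (n * L) (Kof n L k m) := by
  obtain ⟨ν, hν⟩ : ∃ ν, m ν ≠ mstar n L (k ν) := by
    by_contra h
    push Not at h
    exact hm (funext h)
  have hK : Kof n L k m ≠ fun _ => 0 := by
    intro h
    have h0 : ((Kof n L k m ν : Fin (n * L)) : ℕ) = 0 := by rw [congrFun h ν]; exact Fin.val_zero _
    have hm0 : (m ν : ℕ) = 0 := ((Kof_apply_eq_zero_iff n L k m ν).mp h0).2
    have hk0 : (k ν : ℕ) = 0 := ((Kof_apply_eq_zero_iff n L k m ν).mp h0).1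
    apply hν
    apply Fin.ext
    rw [hm0, mstar_val, if_pos (by rw [hk0]; exact Nat.pos_of_ne_zero (NeZero.ne n))]
  have h1 := omega_Kof_far n L (k ν) (m ν) hν
  have h2 := omega_sq_le_W (n * L) (Kof n L k m) hK ν
  rw [Kof_val] at h2
  have hn0 : (0 : ℝ) ≤ (n : ℝ) / 2 := by positivity
  calc (n : ℝ) ^ 2 / 4 = ((n : ℝ) / 2) ^ 2 := by ring
    _ ≤ omega (n * L) ((k ν : ℕ) + n * (m ν : ℕ)) ^ 2 := pow_le_pow_left₀ hn0 h1 2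
    _ ≤ W (n * L) (Kof n L k m) := h2

/-! ## §2 The centred momentum of a coarse alias -/

/-- [folklore] THE CENTRED MOMENTUM of the coarse alias `j`: `z + 2πj` if `2j < n`, `z + 2πj − 2πn` otherwise
(`= z + 2πk̃`, `k̃ ∈ [−n∕2, n∕2)` the centred representative of `j`). -/
def zc (n : ℕ) (j : Fin n) (z : ℂ) : ℂ :=
  if 2 * (j : ℕ) < n then z + 2 * π * (j : ℕ) else z + 2 * π * (j : ℕ) - 2 * π * n

/-- [folklore] centring does not move the imaginary part. -/
theorem zc_im (n : ℕ) (j : Fin n) (z : ℂ) : (zc n j z).im = z.im := by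
  unfold zc; split_ifs <;> simp

/-- [folklore] `S_ξ` at the alias `j` is `S_ξ` at the centred momentum (`2πn`-periodicity). -/
theorem Sxi_shift_eq_zc (n : ℕ) [NeZero n] (j : Fin n) (z : ℂ) : Sxi n (z + 2 * π * (j : ℕ)) = Sxi n (zc n j z) := by
  unfold zc
  split_ifs with h
  · rfl
  · have hn' : (n : ℂ) ≠ 0 := Nat.cast_ne_zero.mpr (NeZero.ne n)
    unfold Sxi
    have e : (z + 2 * ↑π * ↑(j : ℕ) - 2 * ↑π * ↑n) / (n : ℂ) = (z + 2 * ↑π * ↑(j : ℕ)) / n - 2 * π := by field_simp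
    rw [e, Complex.cos_sub_two_pi]

/-- [folklore] `S_{ξ∕L}` at the PRINCIPAL finer alias `j + n·m⋆(j)` is `S_{ξ∕L}` at the centred momentum (`2πnL`-periodicity). -/
theorem Sxi_mul_Kof_mstar_eq_zc (n L : ℕ) [NeZero n] [NeZero L] (j : Fin n) (z : ℂ) :
    Sxi (n * L) (z + 2 * π * (((j : ℕ) + n * ((mstar n L j : Fin L) : ℕ) : ℕ) : ℂ)) = Sxi (n * L) (zc n j z) := by
  have hL := Nat.pos_of_ne_zero (NeZero.ne L)
  have hn' : (n : ℂ) ≠ 0 := Nat.cast_ne_zero.mpr (NeZero.ne n)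
  have hL' : (L : ℂ) ≠ 0 := Nat.cast_ne_zero.mpr (NeZero.ne L)
  rw [mstar_val]
  unfold zc
  split_ifs with h
  · simp
  · unfold Sxi
    congr 3
    have e : (z + 2 * ↑π * (((j : ℕ) + n * (L - 1) : ℕ) : ℂ)) / ((n * L : ℕ) : ℂ)
        = (z + 2 * ↑π * ↑(j : ℕ) - 2 * ↑π * ↑n) / ((n * L : ℕ) : ℂ) + 2 * π := by
      rw [Nat.cast_add, Nat.cast_mul, Nat.cast_sub hL]
      push_cast
      field_simp
      ring
    rw [e, Complex.cos_add_two_pi]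

/-- [folklore] the sub-weight at the principal finer alias is `swc` at the centred momentum. -/
theorem sw_Kof_mstar_eq (n L : ℕ) [NeZero n] [NeZero L] (j : Fin n) (z : ℂ) :
    sw n L ((j : ℕ) + n * ((mstar n L j : Fin L) : ℕ)) z = swc n L (zc n j z) := by
  have hL := Nat.pos_of_ne_zero (NeZero.ne L)
  have hn := Nat.pos_of_ne_zero (NeZero.ne n)
  rw [sw_eq_swc, mstar_val]
  unfold zc
  split_ifs with h
  · simp
  · rw [← swc_add_period n L hn hL (z + 2 * ↑π * ↑(j : ℕ) - 2 * ↑π * ↑n)]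
    congr 1
    rw [Nat.cast_add, Nat.cast_mul, Nat.cast_sub hL]
    push_cast
    ring

/-- [folklore] **`‖zc‖ ≤ 11·ω_n(j)`** on the fat box `|Re z| ≤ π + 1∕4`, `|Im z| ≤ 1∕2`: the centred momentum is controlled by the
alias weight `ω_n(j) = min(j+1, n−j)` of `B4StripSums`. -/
theorem norm_zc_le (n : ℕ) [NeZero n] (j : Fin n) (z : ℂ) (hre : |z.re| ≤ π + 1 / 4) (him : |z.im| ≤ 1 / 2) :
    ‖zc n j z‖ ≤ 11 * omega n (j : ℕ) := by
  have hj := j.isLt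
  have hπ := Real.pi_lt_d2
  have hπ0 := Real.pi_pos
  have hre' := abs_le.mp hre
  have him' := abs_le.mp him
  unfold zc omega
  split_ifs with h
  · have h1 : ((j : ℕ) : ℝ) + 1 ≤ (n : ℝ) - (j : ℕ) := by
      have : (2 * (j : ℕ) + 1 : ℝ) ≤ n := by exact_mod_cast (show 2 * (j : ℕ) + 1 ≤ n by omega)
      linarith
    rw [min_eq_left h1]
    refine (Complex.norm_le_abs_re_add_abs_im _).trans ?_
    have er : (z + 2 * ↑π * ((j : ℕ) : ℂ)).re = z.re + 2 * π * (j : ℕ) := by simp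
    have ei : (z + 2 * ↑π * ((j : ℕ) : ℂ)).im = z.im := by simp
    rw [er, ei]
    have hj0 : (0 : ℝ) ≤ (j : ℕ) := Nat.cast_nonneg _
    have h3 : |z.re + 2 * π * (j : ℕ)| ≤ |z.re| + 2 * π * (j : ℕ) :=
      (abs_add_le _ _).trans (by rw [abs_of_nonneg (by positivity : (0 : ℝ) ≤ 2 * π * (j : ℕ))])
    nlinarith [abs_nonneg z.re, abs_nonneg z.im]
  · push Not at h
    have h1 : (n : ℝ) - (j : ℕ) ≤ ((j : ℕ) : ℝ) + 1 := by
      have : (n : ℝ) ≤ 2 * (j : ℕ) := by exact_mod_cast h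
      linarith
    rw [min_eq_right h1]
    refine (Complex.norm_le_abs_re_add_abs_im _).trans ?_
    have er : (z + 2 * ↑π * ((j : ℕ) : ℂ) - 2 * ↑π * (n : ℂ)).re = z.re - 2 * π * ((n : ℝ) - (j : ℕ)) := by
      simp; ring
    have ei : (z + 2 * ↑π * ((j : ℕ) : ℂ) - 2 * ↑π * (n : ℂ)).im = z.im := by simp
    rw [er, ei]
    have hnj : (1 : ℝ) ≤ (n : ℝ) - (j : ℕ) := by
      have : (j : ℕ) + 1 ≤ n := hj
      have : ((j : ℕ) : ℝ) + 1 ≤ n := by exact_mod_cast this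
      linarith
    have h3 : |z.re - 2 * π * ((n : ℝ) - (j : ℕ))| ≤ |z.re| + 2 * π * ((n : ℝ) - (j : ℕ)) :=
      (abs_sub _ _).trans (by rw [abs_of_nonneg (by nlinarith : (0 : ℝ) ≤ 2 * π * ((n : ℝ) - (j : ℕ)))])
    nlinarith [abs_nonneg z.re, abs_nonneg z.im]

/-- [folklore] the box hypotheses of `norm_zc_le` hold on the fat region (`r ≤ 1∕4`). -/
theorem fat_coord {r : ℝ} (hr : r ≤ 1 / 4) {p : Fin d → ℂ} (hp : p ∈ Fat d r) (ν : Fin d) :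
    |(p ν).re| ≤ π + 1 / 4 ∧ |(p ν).im| ≤ 1 / 2 ∧ |(p ν).im| ≤ 1 :=
  ⟨(hp ν).1.trans (by linarith), (hp ν).2.trans (by linarith), (hp ν).2.trans (by linarith)⟩

end Summit.QuantumFields.BalabanUV.Beta.GAN24.SubAveragingCore
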